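import Summits.HodgeConjecture.HodgeConjecture.Theorems.F0P3ClassificationLawsV8      -- ★ V8-B (F0P3-p03 (g7)): alias `…V8.ClassificationKit`, laws `HatBounded`, `UnrStarAlgebra`, `AutGerm`, `hatAut` (+ ★ V6-A kit p821941, `IsPinned`)
import Summits.HodgeConjecture.HodgeConjecture.Theorems.F0P3UnrStarAlgebraOfPinsV6     -- ★ V6 (F0P3-p03 (g6)): class-summand template; brings ★ p817782 ∕ ★ p817360 (one-place `*`-character analysis), ★ p818298 (unimodularity), ★ p819143 `hanis_of_frame`
import HarnessLib

/-!
# T5 laws (L1-ii) `HatBounded` and (L1-iii) `UnrStarAlgebra` FOR THE WHOLE `AutGerm` — class AND packet summands — FROM THE PINS AND PACKET ANCHORS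

Cell `hodgecm-mathlib`, F0∕P3 «U3-mult», crux H413 (`stmt-HodgeConjecture-24833`), row «T1-RES» (#101, director s599; F0P3-plan RULING (V51)(b), REF1 R-31):
the two PRINT fields `hatBounded : HatBounded (kitK9 …) S₀` ∕ `unrStarAlgebra : UnrStarAlgebra (kitK9 …) S₀` of `OverrideWitness` carried inside the ∃ of
`stub_rung0` (ED. 4 of `Cruxes/H413/Lines/F0_U3LettersRung1.lean`).  B-p12 (g26) for the F0∕P3 desk.  PROOF lane: no `def`, no `sorry`, no named fact;
`--supports stmt-HodgeConjecture-24833 --as helper`.  Kit-parametric over the V8 alias (a V8 kit IS a V6 kit, `rfl`).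

THE MATHEMATICS [Rogawski1990 §13.7 p. 206; Langlands1980 p. 209; CartierCorvallis1979 §IV.1 Cor. 4.1–4.2].  The laws `HatBounded S₀` ∕ `UnrStarAlgebra S₀`
(★ `F0P3ClassificationLawsV8` :130 ∕ :134) quantify over the germs OF AUTOMORPHIC ORIGIN `AutGerm S` (:110): germs of CLASSES `π′` with `Adm S c`, of
`G`-PACKETS `Q` with `ramG Q ⊆ S`, and of `H`-PACKETS `ρ` with `ramH ρ ⊆ S`.  For the class summand both laws are ★ in-house from the pins
(★ `F0P3ClassificationEngineV8.hatBounded_cls_of_pins`, ★ `F0P3UnrStarAlgebraOfPinsV6.unrStarAlgebra_cls_of_pins`): pin (ii) anchors `evp c v` off `ramCls c`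
as the eigencharacter of the `K_v`-SPHERICAL class `clFin c v`, admissible (iv) and unitarizable (v), and the one-place analysis (★ p817229 Langlands' bound
`|t_v(f_v)| ≤ μ_v(K_v)⁻¹ ∫|f_v|`; ★ p817360 `t_v(μ_v(K_v)⁻¹ • f ⋆ g) = t_v(f) t_v(g)`, `t_v(f^*) = \overline{t_v(f)}`, `t_v(𝟙_{K_v}) = 1`) is UNIFORM in the class.
The packet summands have no such anchor in the kit (EngineV8 :97) — so THIS FILE TAKES THE ANCHORS AS HYPOTHESES, in exactly the currency of pins (ii)(iv)(v):

  `hG : ∀ Q v, v ∉ S₀ → v ∉ ramG Q → ∃ π : IrrClass (G′_v), π.IsAdmissible ∧ π.IsUnitarizable ∧ π.IsSphericalWith K_v μ_v (evpG Q v)`  (and `hH` likewise),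

i.e. «off `S₀ ∪ ram`, the e.v.p. of a global packet IS the Hecke eigencharacter of a unitary `K_v`-spherical irreducible» — the definitional half of print
[Rogawski1990 §13.7 p. 206 («e.v.p.»), §12.2; §13.2 for `ξ_H`], true at the genuine witness because the members of the global A-packets are unitary automorphic
representations, unramified off `ram` — and proves BOTH laws at BOTH summands (the class summand re-derived in passing from the pins), so that the analytic half
of rows #6∕#7 (the Hecke bound and the `*`-character property) is kernel-checked for packets exactly as for classes.

* `exists_anchor_of_autGerm` — every germ of automorphic origin off `S ⊇ S₀` has a representative `t` anchored at EVERY `v ∉ S` (class: pins; packets: `hG`∕`hH`).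
* `hatBounded_of_pins_of_anchored (𝔠) (hpin) (hG) (hH) : 𝔠.HatBounded S₀` — (L1-ii) [Langlands1980 p. 209].
* `unrStarAlgebra_of_pins_of_anchored (𝔠) (hpin) (hanis) (hG) (hH) : 𝔠.UnrStarAlgebra S₀` — (L1-iii) [CartierCorvallis1979 §IV.1 Cor. 4.1] (unimodularity of
  `U(H)(L⁺_v)` under the anisotropy binder `hanis`, ★ p818298).
* `unrStarAlgebra_of_frame_of_anchored`, `hatLaws_of_frame_of_anchored` — the same fed by the frame binders `hdef h2` of `shapeGuarded_of_T5` (★ `hanis_of_frame`).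

References: [Rogawski1990] §13.7 p. 206; [Langlands1980] p. 209; [CartierCorvallis1979] §IV.1 Cor. 4.1–4.2; [DeitmarEchterhoff2014] Prop. 6.2.1; [Flath1979] §2.
HONEST LABEL: HC_CM is proved only modulo the printed citations until rung 0 closes.
-/

set_option autoImplicit false
-- project-wide idiom for `Summit.HodgeConjecture.HodgeConjecture.…` (summit = problem name): the namespace IS duplicated
set_option linter.dupNamespace false

noncomputable section

open MeasureTheory NumberField IsDedekindDomain Literature.NumberTheory.Automorphic Literature.NumberTheory.Automorphic.UnitaryGroup
open Summit.HodgeConjecture.HodgeConjecture.Cruxes.H413.F0P3InnerFormClassificationV6 (Gp Places EvpData Germ germ)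
open Summit.HodgeConjecture.HodgeConjecture.Cruxes.H413.F0P3InnerFormClassificationV8 (ClassificationKit)
open scoped ComplexConjugate Matrix ComplexOrder

namespace Summit.HodgeConjecture.HodgeConjecture.Cruxes.H413.F0P3HatLawsOfAnchoredPackets

variable {L : Type} [Field L] [NumberField L] [IsCMField L] {H : Matrix (Fin 3) (Fin 3) L} {ι : L →+* ℂ} {T : GL (Fin 3) ℂ}
  {hT : (T : Matrix (Fin 3) (Fin 3) ℂ)ᴴ * H.map ι * (T : Matrix (Fin 3) (Fin 3) ℂ) = Literature.Geometry.ComplexHyperbolic.BallModel.J}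
  {μ : Measure (Gp L H).automorphicQuotient} [(Gp L H).IsAutomorphicMeasure μ]

/-- **ANCHORS ALONG A GERM OF AUTOMORPHIC ORIGIN** [Rogawski1990 §13.7 p. 206; CartierCorvallis1979 §IV.1 Cor. 4.1]: off `S ⊇ S₀`, every germ in `AutGerm S`
has a representative e.v.p. `t` such that at EVERY `v ∉ S` some admissible, unitarizable, `K_v`-spherical class has eigencharacter `t_v` — for a class germ
the coordinate `clFin c v` (pins (ii)(iv)(v): `v ∉ S ⊇ ramCls c`), for a packet germ the hypothesised anchor (`v ∉ S ⊇ S₀ ∪ ramG Q`).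
[cite: Rogawski1990, §13.7 p. 206] [cite: CartierCorvallis1979, §IV.1 Cor. 4.1] -/
theorem exists_anchor_of_autGerm (𝔠 : ClassificationKit L H ι T hT μ) (hpin : 𝔠.IsPinned) {S₀ : Finset (Places L)}
    (hG : ∀ (Q : 𝔠.PacketG) (v : Places L), v ∉ S₀ → v ∉ 𝔠.ramG Q →
      letI : MeasurableSpace ((cmDatum L 3 H).Local v) := borel _
      ∃ π : IrrClass ((cmDatum L 3 H).Local v), π.IsAdmissible ∧ π.IsUnitarizable ∧
        π.IsSphericalWith (cmLocalIntegralLevel L 3 H v) (𝔠.μv v) (𝔠.evpG Q v))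
    (hH : ∀ (ρ : 𝔠.PacketH) (v : Places L), v ∉ S₀ → v ∉ 𝔠.ramH ρ →
      letI : MeasurableSpace ((cmDatum L 3 H).Local v) := borel _
      ∃ π : IrrClass ((cmDatum L 3 H).Local v), π.IsAdmissible ∧ π.IsUnitarizable ∧
        π.IsSphericalWith (cmLocalIntegralLevel L 3 H v) (𝔠.μv v) (𝔠.evpH ρ v))
    {S : Finset (Places L)} (hS : S₀ ⊆ S) (g : 𝔠.AutGerm S) :
    ∃ t : EvpData L H, germ L H S t = g.1 ∧ ∀ v : Places L, v ∉ S →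
      letI : MeasurableSpace ((cmDatum L 3 H).Local v) := borel _
      ∃ π : IrrClass ((cmDatum L 3 H).Local v), π.IsAdmissible ∧ π.IsUnitarizable ∧
        π.IsSphericalWith (cmLocalIntegralLevel L 3 H v) (𝔠.μv v) (t v) := by
  obtain ⟨-, hsph, -, hadm, hunit, -, -, -, -, -⟩ := hpin
  obtain ⟨t, ht, hor⟩ := g.2
  refine ⟨t, ht, fun v hv => ?_⟩
  rcases hor with ⟨c, hc, rfl⟩ | ⟨Q, hQ, rfl⟩ | ⟨ρ, hρ, rfl⟩
  · -- class germ: `Adm S c = (ramCls c ⊆ ↑S ∧ cptTriv c)`, so `v ∉ ramCls c`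
    have hc' : 𝔠.ramCls c ⊆ (S : Set (Places L)) ∧ 𝔠.cptTriv c := hc
    have hvr : v ∉ 𝔠.ramCls c := fun h => hv (Finset.mem_coe.1 (hc'.1 h))
    exact ⟨𝔠.clFin c v, hadm c v hvr, hunit c v hvr, hsph c v hvr⟩
  · exact hG Q v (fun h => hv (hS h)) (fun h => hv (hQ h))
  · exact hH ρ v (fun h => hv (hS h)) (fun h => hv (hρ h))

/-- **(L1-ii) `HatBounded S₀` FOR THE WHOLE `AutGerm`, FROM THE PINS AND PACKET ANCHORS — Langlands' unitary bound** [Langlands1980 p. 209; Rogawski1990 §13.7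
p. 206]: for `S ⊇ S₀` and every `f^S ∈ Unr S` there is `C = C(f^S)` with `|f^{S∧}(t)| ≤ C` for EVERY germ `t` of automorphic origin (classes AND packets).
Proof: pin (vii) `f^{S∧}(t) = ∏_{v ∈ T} t_v(f_v)` (`T` finite, off `S`); at `v ∈ T` the germ is anchored (`exists_anchor_of_autGerm`) by an admissible unitarizable
`K_v`-spherical class with eigencharacter `t_v`, `μ_v` is Haar (iii) so `μ_v(K_v) ≠ 0`, and ★ p817229 `IsSphericalWith.norm_apply_le_inv_mul_integral_norm` bounds
`|t_v(f_v)| ≤ μ_v(K_v)⁻¹ ∫ |f_v|` independently of the anchor; `C := ∏_{v ∈ T} μ_v(K_v)⁻¹ ∫ |f_v|`.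
[cite: Langlands1980, p. 209] [cite: Rogawski1990, §13.7 p. 206] -/
theorem hatBounded_of_pins_of_anchored (𝔠 : ClassificationKit L H ι T hT μ) (hpin : 𝔠.IsPinned) {S₀ : Finset (Places L)}
    (hG : ∀ (Q : 𝔠.PacketG) (v : Places L), v ∉ S₀ → v ∉ 𝔠.ramG Q →
      letI : MeasurableSpace ((cmDatum L 3 H).Local v) := borel _
      ∃ π : IrrClass ((cmDatum L 3 H).Local v), π.IsAdmissible ∧ π.IsUnitarizable ∧
        π.IsSphericalWith (cmLocalIntegralLevel L 3 H v) (𝔠.μv v) (𝔠.evpG Q v))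
    (hH : ∀ (ρ : 𝔠.PacketH) (v : Places L), v ∉ S₀ → v ∉ 𝔠.ramH ρ →
      letI : MeasurableSpace ((cmDatum L 3 H).Local v) := borel _
      ∃ π : IrrClass ((cmDatum L 3 H).Local v), π.IsAdmissible ∧ π.IsUnitarizable ∧
        π.IsSphericalWith (cmLocalIntegralLevel L 3 H v) (𝔠.μv v) (𝔠.evpH ρ v)) :
    𝔠.HatBounded S₀ := by
  classical
  intro S hS fT
  obtain ⟨-, -, hhaar, -, -, -, hhat, -, -, -⟩ := id hpin
  obtain ⟨T₁, hTS, f, hf, hfac⟩ := hhat S fT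
  -- the per-place constants `μ_v(K_v)⁻¹ ∫ ‖f_v‖`
  refine ⟨∏ v ∈ T₁, (letI : MeasurableSpace ((cmDatum L 3 H).Local v) := borel _
    ((𝔠.μv v).real (cmLocalIntegralLevel L 3 H v : Set ((cmDatum L 3 H).Local v)))⁻¹ * ∫ x, ‖f v x‖ ∂(𝔠.μv v)), fun g => ?_⟩
  obtain ⟨t, ht, hanch⟩ := exists_anchor_of_autGerm 𝔠 hpin hG hH hS g
  show ‖𝔠.hat S g.1 fT‖ ≤ _
  rw [← ht, hfac t]
  refine (Finset.norm_prod_le _ _).trans (Finset.prod_le_prod (fun v _ => norm_nonneg _) fun v hv => ?_)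
  -- at `v ∈ T₁`: `v ∉ S`, hence anchored
  have hvS : v ∉ S := fun h => Finset.disjoint_left.1 hTS hv h
  letI : MeasurableSpace ((cmDatum L 3 H).Local v) := borel _
  haveI : BorelSpace ((cmDatum L 3 H).Local v) := ⟨rfl⟩
  haveI : (𝔠.μv v).IsHaarMeasure := hhaar v
  obtain ⟨hKc, hKo⟩ := UnitaryGroup.isCompact_isOpen_cmLocalIntegralLevel L 3 H v
  have hμK : (𝔠.μv v).real (cmLocalIntegralLevel L 3 H v : Set ((cmDatum L 3 H).Local v)) ≠ 0 := by
    rw [measureReal_def, ENNReal.toReal_ne_zero]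
    exact ⟨(hKo.measure_pos (𝔠.μv v) ⟨1, (cmLocalIntegralLevel L 3 H v).one_mem⟩).ne', hKc.measure_lt_top.ne⟩
  obtain ⟨π, hadm, hunit, hsph⟩ := hanch v hvS
  exact hsph.norm_apply_le_inv_mul_integral_norm (𝔠.μv v) hadm hunit hKo hKc hμK (hf v hv).1 (hf v hv).2

/-- **(L1-iii) `UnrStarAlgebra S₀` FOR THE WHOLE `AutGerm`, FROM THE PINS AND PACKET ANCHORS — the e.v.p.'s of automorphic origin are unital `*`-characters of
`⊗_{v∉S} 𝓗_v`** [CartierCorvallis1979 §IV.1 Cor. 4.1; Rogawski1990 §13.7 p. 206; DeitmarEchterhoff2014 Prop. 6.2.1]: for every `S ⊇ S₀`,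
(1) PRODUCT — for `f^S, g^S ∈ Unr S` there is `h^S ∈ Unr S` with `h^{S∧}(t) = f^{S∧}(t) · g^{S∧}(t)` for EVERY germ `t` of automorphic origin;
(2) STAR — for `f^S` there is `g^S` with `g^{S∧}(t) = \overline{f^{S∧}(t)}` for every such `t` (unimodular `G′_v`);
(3) UNIT — there is `u^S` with `u^{S∧}(t) = 1` for every such `t`.
Proof: as ★ `unrStarAlgebra_cls_of_pins` — pin (vii) factorises `f^{S∧}`, `g^{S∧}` over finite `T₁`, `T₂` off `S`; pad both families by `𝟙_{K_v}`, form
`h_v := μ_v(K_v)⁻¹ • (f_v ⋆ g_v)` on `T₁ ∪ T₂` (resp. `f_v^*` on `T₁`, resp. the empty family) and realise it in `Unr S` by the richness pin (viii); along a germ of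
automorphic origin every `v ∈ T₁ ∪ T₂` (off `S`) is ANCHORED (`exists_anchor_of_autGerm`), and ★ p817360 `IsSphericalWith.apply_inv_smul_mulConv` ∕ `apply_mulStar` ∕
`apply_indicator_eq_one` give the identities placewise.  Unimodularity of `U(H)(L⁺_v)` (every Haar `μ_v` inversion-invariant, needed by `f ↦ f^*`) is ★ p818298
`UnitaryGroup.isInvInvariant_cmDatum_local_of_anisotropic` under the ANISOTROPY binder `hanis` (T1's `IsAnisotropic L H`).
[cite: CartierCorvallis1979, §IV.1 Cor. 4.1] [cite: Rogawski1990, §13.7 p. 206] [cite: DeitmarEchterhoff2014, Prop. 6.2.1] -/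
theorem unrStarAlgebra_of_pins_of_anchored (𝔠 : ClassificationKit L H ι T hT μ) (hpin : 𝔠.IsPinned)
    (hanis : ∀ x : Fin 3 → L, Literature.AlgebraicGeometry.ShimuraVarieties.hermForm (cmConjRingHom L) H x x = 0 → x = 0)
    {S₀ : Finset (Places L)}
    (hG : ∀ (Q : 𝔠.PacketG) (v : Places L), v ∉ S₀ → v ∉ 𝔠.ramG Q →
      letI : MeasurableSpace ((cmDatum L 3 H).Local v) := borel _
      ∃ π : IrrClass ((cmDatum L 3 H).Local v), π.IsAdmissible ∧ π.IsUnitarizable ∧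
        π.IsSphericalWith (cmLocalIntegralLevel L 3 H v) (𝔠.μv v) (𝔠.evpG Q v))
    (hH : ∀ (ρ : 𝔠.PacketH) (v : Places L), v ∉ S₀ → v ∉ 𝔠.ramH ρ →
      letI : MeasurableSpace ((cmDatum L 3 H).Local v) := borel _
      ∃ π : IrrClass ((cmDatum L 3 H).Local v), π.IsAdmissible ∧ π.IsUnitarizable ∧
        π.IsSphericalWith (cmLocalIntegralLevel L 3 H v) (𝔠.μv v) (𝔠.evpH ρ v)) :
    𝔠.UnrStarAlgebra S₀ := by
  classical
  intro S hS
  obtain ⟨-, -, hhaar, -, -, -, hhat, hrich, -, -⟩ := id hpin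
  letI : ∀ v, MeasurableSpace ((cmDatum L 3 H).Local v) := fun v => borel _
  haveI : ∀ v, BorelSpace ((cmDatum L 3 H).Local v) := fun v => ⟨rfl⟩
  haveI : ∀ v, (𝔠.μv v).IsHaarMeasure := hhaar
  haveI : ∀ v, (𝔠.μv v).IsInvInvariant := fun v => UnitaryGroup.isInvInvariant_cmDatum_local_of_anisotropic L H v hanis (𝔠.μv v)
  have hK := fun v => UnitaryGroup.isCompact_isOpen_cmLocalIntegralLevel L 3 H v
  have hμK : ∀ v, (𝔠.μv v).real (cmLocalIntegralLevel L 3 H v : Set ((cmDatum L 3 H).Local v)) ≠ 0 := fun v => by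
    rw [measureReal_def, ENNReal.toReal_ne_zero]
    exact ⟨((hK v).2.measure_pos (𝔠.μv v) ⟨1, (cmLocalIntegralLevel L 3 H v).one_mem⟩).ne', (hK v).1.measure_lt_top.ne⟩
  -- the unit `𝟙_{K_v}` and padding of a family given on `T₀` by `𝟙` off `T₀`
  let one : ∀ v : Places L, (cmDatum L 3 H).Local v → ℂ := fun v =>
    (cmLocalIntegralLevel L 3 H v : Set ((cmDatum L 3 H).Local v)).indicator fun _ => (1 : ℂ)
  have hone : ∀ v, HasCompactSupport (one v) ∧ IsLevel (cmLocalIntegralLevel L 3 H v) (one v) := fun v =>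
    ⟨(indicator_mem_schwartzBruhat (hK v).2 (hK v).1).2, IsLevel.indicator (hK v).2 (hK v).1⟩
  have pad : ∀ (T₀ : Finset (Places L)) (f : ∀ v : Places L, (cmDatum L 3 H).Local v → ℂ),
      (∀ v ∈ T₀, HasCompactSupport (f v) ∧ IsLevel (cmLocalIntegralLevel L 3 H v) (f v)) →
      ∃ F : ∀ v : Places L, (cmDatum L 3 H).Local v → ℂ, (∀ v ∈ T₀, F v = f v) ∧ (∀ v, v ∉ T₀ → F v = one v) ∧
        ∀ v, HasCompactSupport (F v) ∧ IsLevel (cmLocalIntegralLevel L 3 H v) (F v) := by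
    intro T₀ f hf
    refine ⟨fun v => if v ∈ T₀ then f v else one v, fun v hv => if_pos hv, fun v hv => if_neg hv, fun v => ?_⟩
    by_cases hv : v ∈ T₀
    · simp only [hv, ↓reduceIte]; exact hf v hv
    · simp only [hv, ↓reduceIte]; exact hone v
  -- along an anchored e.v.p. `t` (anchored at every `v ∉ S`): the unit value and PADDING INVARIANCE [Flath1979 §2]
  have padded : ∀ (t : EvpData L H), (∀ v : Places L, v ∉ S → ∃ π : IrrClass ((cmDatum L 3 H).Local v),
        π.IsAdmissible ∧ π.IsUnitarizable ∧ π.IsSphericalWith (cmLocalIntegralLevel L 3 H v) (𝔠.μv v) (t v)) →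
      ∀ (T₀ T' : Finset (Places L)), T₀ ⊆ T' → Disjoint T' S → ∀ F : ∀ v : Places L, (cmDatum L 3 H).Local v → ℂ,
        (∀ v, v ∉ T₀ → F v = one v) → ∏ v ∈ T₀, t v (F v) = ∏ v ∈ T', t v (F v) := by
    intro t hanch T₀ T' hTT' hT'S F hFoff
    refine Finset.prod_subset hTT' fun v hv hv₀ => ?_
    have hvS : v ∉ S := fun h => Finset.disjoint_left.1 hT'S hv h
    obtain ⟨π, -, -, hsph⟩ := hanch v hvS
    rw [hFoff v hv₀]
    exact hsph.apply_indicator_eq_one (𝔠.μv v) (hK v).2 (hK v).1 (hμK v)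
  refine ⟨fun fT gT => ?_, fun fT => ?_, ?_⟩
  · -- (1) PRODUCT
    obtain ⟨T₁, hT₁, f, hf, hfac⟩ := hhat S fT
    obtain ⟨T₂, hT₂, g, hg, hgac⟩ := hhat S gT
    obtain ⟨F, hFT, hFoff, hF⟩ := pad T₁ f hf
    obtain ⟨G, hGT, hGoff, hG'⟩ := pad T₂ g hg
    have hT₁₂ : Disjoint (T₁ ∪ T₂) S := Finset.disjoint_union_left.2 ⟨hT₁, hT₂⟩
    obtain ⟨hT', hhT'⟩ := hrich S (T₁ ∪ T₂) hT₁₂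
      (fun v => (((𝔠.μv v).real (cmLocalIntegralLevel L 3 H v : Set ((cmDatum L 3 H).Local v)) : ℂ)⁻¹) • mulConv (𝔠.μv v) (F v) (G v))
      (fun v _ => ⟨(hasCompactSupport_mulConv (𝔠.μv v) (hF v).1 (hG' v).1).smul_left
        (f := fun _ => (((𝔠.μv v).real (cmLocalIntegralLevel L 3 H v : Set ((cmDatum L 3 H).Local v)) : ℂ)⁻¹)),
        ((hF v).2.mulConv (𝔠.μv v) (hG' v).2).smul _⟩)
    refine ⟨hT', fun a => ?_⟩
    obtain ⟨t, ht, hanch⟩ := exists_anchor_of_autGerm 𝔠 hpin hG hH hS a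
    show 𝔠.hat S a.1 hT' = 𝔠.hat S a.1 fT * 𝔠.hat S a.1 gT
    have ef : ∏ v ∈ T₁, t v (f v) = ∏ v ∈ T₁, t v (F v) := Finset.prod_congr rfl fun v hv => by rw [hFT v hv]
    have eg : ∏ v ∈ T₂, t v (g v) = ∏ v ∈ T₂, t v (G v) := Finset.prod_congr rfl fun v hv => by rw [hGT v hv]
    rw [← ht, hhT', hfac, hgac, ef, eg, padded t hanch T₁ (T₁ ∪ T₂) Finset.subset_union_left hT₁₂ F hFoff,
      padded t hanch T₂ (T₁ ∪ T₂) Finset.subset_union_right hT₁₂ G hGoff, ← Finset.prod_mul_distrib]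
    refine Finset.prod_congr rfl fun v hv => ?_
    have hvS : v ∉ S := fun h => Finset.disjoint_left.1 hT₁₂ hv h
    obtain ⟨π, hadm, -, hsph⟩ := hanch v hvS
    exact hsph.apply_inv_smul_mulConv (𝔠.μv v) hadm (hμK v) (hF v).1 (hF v).2 (hG' v).1 (hG' v).2
  · -- (2) STAR
    obtain ⟨T₁, hT₁, f, hf, hfac⟩ := hhat S fT
    obtain ⟨F, hFT, -, hF⟩ := pad T₁ f hf
    obtain ⟨gT', hgT'⟩ := hrich S T₁ hT₁ (fun v => mulStar (F v))
      (fun v _ => ⟨hasCompactSupport_mulStar (hF v).1, (hF v).2.mulStar⟩)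
    refine ⟨gT', fun a => ?_⟩
    obtain ⟨t, ht, hanch⟩ := exists_anchor_of_autGerm 𝔠 hpin hG hH hS a
    show 𝔠.hat S a.1 gT' = starRingEnd ℂ (𝔠.hat S a.1 fT)
    have ef : ∏ v ∈ T₁, t v (f v) = ∏ v ∈ T₁, t v (F v) := Finset.prod_congr rfl fun v hv => by rw [hFT v hv]
    rw [← ht, hgT', hfac, ef, map_prod]
    refine Finset.prod_congr rfl fun v hv => ?_
    have hvS : v ∉ S := fun h => Finset.disjoint_left.1 hT₁ hv h
    obtain ⟨π, hadm, hunit, hsph⟩ := hanch v hvS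
    exact hsph.apply_mulStar (𝔠.μv v) hadm hunit (hμK v) (hF v).1 (hF v).2
  · -- (3) UNIT
    obtain ⟨uT, huT⟩ := hrich S ∅ (Finset.disjoint_empty_left S) one (fun v _ => hone v)
    refine ⟨uT, fun a => ?_⟩
    obtain ⟨t, ht, -⟩ := a.2
    show 𝔠.hat S a.1 uT = 1
    rw [← ht, huT, Finset.prod_empty]

/-- **(L1-iii) for the whole `AutGerm`, FED BY THE FRAME BINDERS of `shapeGuarded_of_T5`** (`hdef`, `h2` ⇒ ★ `hanis_of_frame`; no new binder surfaces beyond the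
packet anchors). [cite: Rogawski1990, §13.7 p. 206] [cite: CartierCorvallis1979, §IV.1 Cor. 4.1] -/
theorem unrStarAlgebra_of_frame_of_anchored (𝔠 : ClassificationKit L H ι T hT μ) (hpin : 𝔠.IsPinned)
    (hdef : ∀ τ' : L →+* ℂ, InfinitePlace.mk τ' ≠ InfinitePlace.mk ι → (H.map τ').PosDef) (h2 : 2 ≤ Module.finrank ℚ ↥(maximalRealSubfield L))
    {S₀ : Finset (Places L)}
    (hG : ∀ (Q : 𝔠.PacketG) (v : Places L), v ∉ S₀ → v ∉ 𝔠.ramG Q →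
      letI : MeasurableSpace ((cmDatum L 3 H).Local v) := borel _
      ∃ π : IrrClass ((cmDatum L 3 H).Local v), π.IsAdmissible ∧ π.IsUnitarizable ∧
        π.IsSphericalWith (cmLocalIntegralLevel L 3 H v) (𝔠.μv v) (𝔠.evpG Q v))
    (hH : ∀ (ρ : 𝔠.PacketH) (v : Places L), v ∉ S₀ → v ∉ 𝔠.ramH ρ →
      letI : MeasurableSpace ((cmDatum L 3 H).Local v) := borel _
      ∃ π : IrrClass ((cmDatum L 3 H).Local v), π.IsAdmissible ∧ π.IsUnitarizable ∧
        π.IsSphericalWith (cmLocalIntegralLevel L 3 H v) (𝔠.μv v) (𝔠.evpH ρ v)) :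
    𝔠.UnrStarAlgebra S₀ :=
  unrStarAlgebra_of_pins_of_anchored 𝔠 hpin (F0P3UnrStarAlgebraOfPins.hanis_of_frame hdef h2) hG hH

/-- **ROWS #6 AND #7 OF THE T1 LETTER PACKAGE AT BOTH SUMMANDS, FROM THE PINS, THE FRAME AND THE PACKET ANCHORS** — the conjunction the K9β closer reads as
`h6 ∧ h7` (T1-RES, #101): `HatBounded S₀ ∧ UnrStarAlgebra S₀`. [cite: Langlands1980, p. 209] [cite: CartierCorvallis1979, §IV.1 Cor. 4.1–4.2] [cite: Rogawski1990, §13.7 p. 206] -/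
theorem hatLaws_of_frame_of_anchored (𝔠 : ClassificationKit L H ι T hT μ) (hpin : 𝔠.IsPinned)
    (hdef : ∀ τ' : L →+* ℂ, InfinitePlace.mk τ' ≠ InfinitePlace.mk ι → (H.map τ').PosDef) (h2 : 2 ≤ Module.finrank ℚ ↥(maximalRealSubfield L))
    {S₀ : Finset (Places L)}
    (hG : ∀ (Q : 𝔠.PacketG) (v : Places L), v ∉ S₀ → v ∉ 𝔠.ramG Q →
      letI : MeasurableSpace ((cmDatum L 3 H).Local v) := borel _
      ∃ π : IrrClass ((cmDatum L 3 H).Local v), π.IsAdmissible ∧ π.IsUnitarizable ∧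
        π.IsSphericalWith (cmLocalIntegralLevel L 3 H v) (𝔠.μv v) (𝔠.evpG Q v))
    (hH : ∀ (ρ : 𝔠.PacketH) (v : Places L), v ∉ S₀ → v ∉ 𝔠.ramH ρ →
      letI : MeasurableSpace ((cmDatum L 3 H).Local v) := borel _
      ∃ π : IrrClass ((cmDatum L 3 H).Local v), π.IsAdmissible ∧ π.IsUnitarizable ∧
        π.IsSphericalWith (cmLocalIntegralLevel L 3 H v) (𝔠.μv v) (𝔠.evpH ρ v)) :
    𝔠.HatBounded S₀ ∧ 𝔠.UnrStarAlgebra S₀ :=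
  ⟨hatBounded_of_pins_of_anchored 𝔠 hpin hG hH, unrStarAlgebra_of_frame_of_anchored 𝔠 hpin hdef h2 hG hH⟩

end Summit.HodgeConjecture.HodgeConjecture.Cruxes.H413.F0P3HatLawsOfAnchoredPackets

end
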